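import Summits.AtomisticToContinuum.HydrodynamicLimit.Theorems.RelayRaceLocalityNearConstantShortTimeHLIntCapMarkov
import HarnessLib

/-!
# Crux `NearConstantShortTimeHL` (stmt-AtomisticToContinuum-12502), line `small-tilt-domination` (skeleton v24, lead c9):
# Markov bound for the integrated EXPONENTIAL velocity moment along the true law

Support file for the crux `…Theses.RelayRaceLocality.NearConstantShortTimeHL`, line `small-tilt-domination`,
registered helper **`intExpMoment_markov`** of the stub `stub_reductionPX` (twin of the landed `intFourthMoment_markovE`,
`…IntCapMarkovE`, in the currency of skeleton v24: the integrated EXPONENTIAL cap `intExpCapOn`, `…ExpCapDefs`, replaces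
the integrated quartic cap in the equilibrium closure events).

For a hard-sphere flow `Φ` on `𝕋³`, a finite law `P ≪ Liouville` with the first exponential velocity moment in mean on
`[0, t]`, `E_P n⁻¹ Σᵢ exp ‖vᵢ(s)‖ ≤ A` for `s ∈ [0, t]`, the INTEGRATED exponential cap `∫₀ᵗ n⁻¹ Σᵢ exp ‖vᵢ(r)‖ dr ≤ K`
fails with probability at most `t A / K`:

* replace the flow by its jointly measurable version (`xb_exists_measurable_flow`), which changes nothing on good,
  i.e. `P`-almost all, initial data;
* Markov's inequality for `z ↦ ∫₀ᵗ n⁻¹ Σᵢ exp ‖vᵢ(r)‖ dr` and Tonelli (`ym_meas_ge_timeIntegral_le`) to evaluate its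
  mean as `∫₀ᵗ E_P n⁻¹ Σᵢ exp ‖vᵢ(r)‖ dr ≤ t · A`.

The proof is the landed proof of `intFourthMoment_markovE` (`…IntCapMarkovE`) minus the pointwise domination step
`x⁴ ≤ (24/b⁴) e^{bx}`. Helpers are prefixed `yx_`. No definitions, no named facts. References: H.-T. Yau, Lett. Math.
Phys. 22 (1991) §2 (the relative-entropy method; this is one of its bookkeeping facts); R. K. Alexander, PhD thesis (1975)
Ch. 2 (measurability of the flow).
-/

noncomputable section

namespace Summit.AtomisticToContinuum.HydrodynamicLimit.Theorems.NearConstantShortTimeHL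

open scoped BigOperators ENNReal
open MeasureTheory Set Filter
open Literature.MathematicalPhysics.KineticTheory Literature.Analysis.FluidPDE Literature.Analysis.FunctionSpaces

/-! ## Measurability of the exponential velocity moment per particle -/

-- adapted from `ym_measurable_fourthMoment` (`…IntCapMarkov`): `‖·‖ ^ 4` → `exp ‖·‖`
/-- The exponential velocity moment per particle `n⁻¹ Σᵢ exp ‖vᵢ‖` is a measurable function of the configuration (a
finite sum of continuous functions of one velocity coordinate). [folklore] -/
theorem yx_measurable_expMoment {n : ℕ} :
    Measurable fun w : Config n (Fin 3) T3 => (n : ℝ)⁻¹ * ∑ i : Fin n, Real.exp ‖(w i).2‖ := by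
  have hv : ∀ i : Fin n, Measurable fun w : Config n (Fin 3) T3 => (w i).2 := fun i =>
    (measurable_pi_apply i).snd
  exact (Finset.measurable_sum _ fun i _ => (hv i).norm.exp).const_mul _

/-! ## The registered helper -/

-- adapted from `intFourthMoment_markovE` (`…IntCapMarkovE`): the pointwise step is dropped, the observable IS the moment
/-- **Registered helper `intExpMoment_markov`.** For a hard-sphere flow `Φ` on `𝕋³` and a finite law `P ≪ Liouville`
with the first exponential velocity moment in mean on `[0, t]`, `E_P n⁻¹ Σᵢ exp ‖vᵢ(s)‖ ≤ A` (`s ∈ [0, t]`), the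
integrated exponential cap fails with small probability: `P {K < ∫₀ᵗ n⁻¹ Σᵢ exp ‖vᵢ(r)‖ dr} ≤ t A / K` for every
`K > 0`. Proof: the flow is replaced by its jointly measurable version (`xb_exists_measurable_flow`) off a `P`-null set;
Markov's inequality and Tonelli along `[0, t] × Config` (`ym_meas_ge_timeIntegral_le`). [cite: Yau1991, §2] -/
theorem intExpMoment_markov : ∀ {ε : ℝ} {n : ℕ} (Φ : HardSphereFlow (Torus.geometry (Fin 3)) ε n) (P : Measure (Config n (Fin 3) T3)) [IsFiniteMeasure P], P ≪ liouville (Torus.geometry (Fin 3)) n ε → ∀ {A t : ℝ}, 0 ≤ A → 0 ≤ t → (∀ s ∈ Set.Icc 0 t, ∫⁻ z, ENNReal.ofReal ((n : ℝ)⁻¹ * ∑ i : Fin n, Real.exp ‖((Φ.flow s z) i).2‖) ∂P ≤ ENNReal.ofReal A) → ∀ K : ℝ, 0 < K → P {z | ENNReal.ofReal K < ∫⁻ r in Set.Icc 0 t, ENNReal.ofReal ((n : ℝ)⁻¹ * ∑ i : Fin n, Real.exp ‖((Φ.flow r z) i).2‖)} ≤ ENNReal.ofReal (t * A / K) := by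
  intro ε n Φ P _ hP A t hA _ hexp K hK
  obtain ⟨F, hFm, hF⟩ := xb_exists_measurable_flow Φ
  have hgood : ∀ᵐ z ∂P, z ∈ Φ.good := hP.ae_le Φ.ae_mem_good
  -- the jointly measurable integrand (flow replaced by its measurable version)
  have hGm : Measurable fun p : ℝ × Config n (Fin 3) T3 =>
      ENNReal.ofReal ((n : ℝ)⁻¹ * ∑ i : Fin n, Real.exp ‖((F p) i).2‖) :=
    (yx_measurable_expMoment.comp hFm).ennreal_ofReal
  -- the slice means are bounded by `A` on `[0, t]`
  have hB : ∀ r ∈ Icc 0 t,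
      ∫⁻ z, ENNReal.ofReal ((n : ℝ)⁻¹ * ∑ i : Fin n, Real.exp ‖((F (r, z)) i).2‖) ∂P ≤ ENNReal.ofReal A := by
    intro r hr
    calc ∫⁻ z, ENNReal.ofReal ((n : ℝ)⁻¹ * ∑ i : Fin n, Real.exp ‖((F (r, z)) i).2‖) ∂P
        = ∫⁻ z, ENNReal.ofReal ((n : ℝ)⁻¹ * ∑ i : Fin n, Real.exp ‖((Φ.flow r z) i).2‖) ∂P := by
          refine lintegral_congr_ae ?_
          filter_upwards [hgood] with z hz
          rw [hF r z hz]
      _ ≤ ENNReal.ofReal A := hexp r hr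
  -- Markov and Tonelli for the measurable version
  have hmain : P {z | ENNReal.ofReal K ≤
      ∫⁻ r in Icc 0 t, ENNReal.ofReal ((n : ℝ)⁻¹ * ∑ i : Fin n, Real.exp ‖((F (r, z)) i).2‖)} ≤
        ENNReal.ofReal A * ENNReal.ofReal t / ENNReal.ofReal K :=
    ym_meas_ge_timeIntegral_le P hGm t hB (ENNReal.ofReal_pos.2 hK).ne' ENNReal.ofReal_ne_top
  -- the constants
  have hconst : ENNReal.ofReal A * ENNReal.ofReal t / ENNReal.ofReal K = ENNReal.ofReal (t * A / K) := by
    rw [← ENNReal.ofReal_mul hA, ENNReal.ofReal_div_of_pos hK, mul_comm A t]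
  -- the event along the flow is a.e. contained in the event for the measurable version
  calc P {z | ENNReal.ofReal K <
          ∫⁻ r in Icc 0 t, ENNReal.ofReal ((n : ℝ)⁻¹ * ∑ i : Fin n, Real.exp ‖((Φ.flow r z) i).2‖)}
      ≤ P {z | ENNReal.ofReal K ≤
          ∫⁻ r in Icc 0 t, ENNReal.ofReal ((n : ℝ)⁻¹ * ∑ i : Fin n, Real.exp ‖((F (r, z)) i).2‖)} := by
        refine measure_mono_ae ?_
        filter_upwards [hgood] with z hz h
        change ENNReal.ofReal K ≤ _
        replace h : ENNReal.ofReal K <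
            ∫⁻ r in Icc 0 t, ENNReal.ofReal ((n : ℝ)⁻¹ * ∑ i : Fin n, Real.exp ‖((Φ.flow r z) i).2‖) := h
        refine h.le.trans (le_of_eq (lintegral_congr fun r => ?_))
        rw [hF r z hz]
    _ ≤ ENNReal.ofReal A * ENNReal.ofReal t / ENNReal.ofReal K := hmain
    _ = ENNReal.ofReal (t * A / K) := hconst

end Summit.AtomisticToContinuum.HydrodynamicLimit.Theorems.NearConstantShortTimeHL

end
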